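import Literature.NumberTheory.EllipticCurves.RationalIsogenyDegreesProofs
import Literature.NumberTheory.EllipticCurves.IsogenyClassFiniteProofs
import Literature.NumberTheory.EllipticCurves.GaloisStableDivisibleSubgroupProofs
import HarnessLib

/-!
# No `Γ_K`-stable `p`-divisible line on an elliptic curve over a NUMBER FIELD without `K`-rational CM

Cell `bsd-print-cf2`, seat `bsd-line-cf2-p1-w2` g4 (prover, width seat on crux stmt-BirchSwinnertonDyer-20368
`PrintCf2.SplitBadTwoRankOneOfFacts`, line `eisenstein_two_bdp_line` v8.1 ff08fa12, stub **`stub_finGlob_two`**: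
`Finite (E(K_∞)[2^∞])` for `E = W.baseChange K` over the anticyclotomic `ℤ₂`-tower of an imaginary quadratic `K`).
`--supports stmt-BirchSwinnertonDyer-20368` (helper). ROUTE-FREE. THEOREMS ONLY (0 definitions, 0 named facts, 0 `sorry`).
BSD is not advanced by any of this; no summit statement is proved by this seat.

WHAT THIS IS. The PORT to an arbitrary number field `K` of the tree's
`Literature/NumberTheory/EllipticCurves/GaloisStableDivisibleSubgroupProofs.lean` (there: `E/ℚ`, where `End_ℚ(E) = ℤ` is a theorem,
`not_hasRationalCM_holds`). Over `K` the absence of `K`-rational complex multiplication is a HYPOTHESIS `¬ W.HasRationalCM` (true e.g.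
for the base change to `K` of a CM curve over `ℚ` whose CM field is not contained in `K` — the case of the split-bad class
`49a1^{(d)}` over a Heegner field `K ∌ √−7`); Shafarevich's finiteness of the `K`-isogeny class (`finite_isogenyClass_holds`, any number
field) and the quotient isogenies (`exists_isogeny_ker_eq_and_comp_eq_nsmul_holds`, any perfect field) are already `K`-general in the
tree, so the proof is the `ℚ`-proof VERBATIM:

* `WeierstrassCurve.geomTorsion_le_of_stable_divisible_of_not_hasRationalCM` — a non-zero `Γ_K`-stable `p`-primary `p`-divisible
  `D ≤ E(K̄)` contains `E[p]` (else the cyclic layers `D ⊓ E[p^k]` give `K`-isogenies `E → E_k` of degree `p^k`, two of the `E_k` are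
  `K`-isomorphic by Shafarevich, and `f_j ∘ ι ∘ g_k ∈ End_K(E) = ℤ` has the wrong kernel);
* `…geomTorsion_pow_le…`, **`WeierstrassCurve.geomPrimaryTorsion_le_of_stable_divisible_of_not_hasRationalCM`** — hence `E[p^∞] ≤ D`.
Use (next file): the stable image of an infinite `E(K_∞)[p^∞]` is such a `D`, so `E(K_∞)[p^∞]` infinite ⟹ `Γ_{K_∞}` fixes `E[p^∞]` ⟹
the cyclotomic character dies on `Gal(K̄/K_∞)` — impossible on an anticyclotomic tower (`stub_finGlob_two` for `K ∌ √−7`).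

References: [SilvermanAEC2009] Prop. III.4.12, Thm. III.6.1, Cor. IX.6.2; [Serre1968] IV.2.1–2.2 (no CM over `K`); [GreenbergLNM1716] §1 p. 62.
-/

noncomputable section

open scoped Classical AddSubgroup

universe u

/-! ## Divisible subgroups: iterated division and the layers `D ⊓ A[p^k]` (verbatim the `ℚ`-file's private lemmas) -/

namespace Summit.BirchSwinnertonDyer.BirchSwinnertonDyer.Theorems.StableDivisibleNF

variable {A : Type u} [AddCommGroup A] {p : ℕ} {D : AddSubgroup A}

/-- In a `p`-divisible subgroup every element is a `p^k`-th multiple, for every `k`. [folklore] -/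
private theorem exists_pow_smul_eq (hdiv : ∀ x ∈ D, ∃ y ∈ D, p • y = x) (k : ℕ) {x : A}
    (hx : x ∈ D) :
    ∃ y ∈ D, p ^ k • y = x := by
  induction k generalizing x with
  | zero => exact ⟨x, hx, by rw [pow_zero, one_smul]⟩
  | succ k ih =>
    obtain ⟨y, hy, rfl⟩ := hdiv x hx
    obtain ⟨z, hz, rfl⟩ := ih hy
    exact ⟨z, hz, by rw [pow_succ', mul_smul]⟩

/-- A non-zero `p`-primary subgroup contains a non-zero element killed by `p`. [folklore] -/
private theorem exists_ne_zero_p_smul_eq_zero (hprim : ∀ x ∈ D, ∃ k : ℕ, p ^ k • x = 0)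
    (hne : D ≠ ⊥) :
    ∃ x ∈ D, x ≠ 0 ∧ p • x = 0 := by
  obtain ⟨x, hxD, hx0⟩ : ∃ x ∈ D, x ≠ 0 := by
    by_contra h
    push Not at h
    exact hne ((AddSubgroup.eq_bot_iff_forall _).mpr h)
  have hex : ∃ k : ℕ, p ^ k • x = 0 := hprim x hxD
  have hk0 : Nat.find hex ≠ 0 := by
    intro h0
    have h := Nat.find_spec hex
    rw [h0, pow_zero, one_smul] at h
    exact hx0 h
  obtain ⟨j, hj⟩ := Nat.exists_eq_add_one_of_ne_zero hk0
  refine ⟨p ^ j • x, D.nsmul_mem hxD _, Nat.find_min hex (by rw [hj]; exact Nat.lt_succ_self j),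
    ?_⟩
  rw [smul_smul, ← pow_succ', ← hj]
  exact Nat.find_spec hex

/-- **The layers of a divisible subgroup.** If `D` is `p`-divisible and `#(D ⊓ A[p]) = p`, then for
every `k` the layer `D ⊓ A[p^k]` has exactly `p^k` elements and contains an element of order `p^k`
(induction along `x ↦ p^k • x : D ⊓ A[p^{k+1}] → D ⊓ A[p]`, which is onto by divisibility with
kernel `D ⊓ A[p^k]`). [folklore] -/
private theorem natCard_inf_torsionBy_pow_eq [Fact p.Prime] (hdiv : ∀ x ∈ D, ∃ y ∈ D, p • y = x)
    (hcard : Nat.card ↥(D ⊓ A[(p : ℕ)]) = p) (k : ℕ) :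
    Nat.card ↥(D ⊓ A[(p ^ k : ℕ)]) = p ^ k ∧ ∃ x ∈ D ⊓ A[(p ^ k : ℕ)], addOrderOf x = p ^ k := by
  have hp : p.Prime := Fact.out
  induction k with
  | zero =>
    have hbot : D ⊓ A[(p ^ 0 : ℕ)] = ⊥ := by
      refine (AddSubgroup.eq_bot_iff_forall _).mpr fun x hx ↦ ?_
      have h := AddSubgroup.torsionBy.nsmul_iff.mp hx.2
      rwa [pow_zero, one_smul] at h
    refine ⟨by rw [hbot, AddSubgroup.card_bot, pow_zero], 0, (D ⊓ _).zero_mem, ?_⟩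
    rw [pow_zero, addOrderOf_zero]
  | succ k ih =>
    obtain ⟨ihcard, -⟩ := ih
    -- the map `x ↦ p^k • x : D ⊓ A[p^{k+1}] → D ⊓ A[p]`
    have hmapsto : ∀ x ∈ D ⊓ A[(p ^ (k + 1) : ℕ)], p ^ k • x ∈ D ⊓ A[(p : ℕ)] := fun x hx ↦ by
      refine ⟨D.nsmul_mem hx.1 _, AddSubgroup.torsionBy.nsmul_iff.mpr ?_⟩
      rw [smul_smul, ← pow_succ', ← AddSubgroup.torsionBy.nsmul_iff]
      exact hx.2
    let m : ↥(D ⊓ A[(p ^ (k + 1) : ℕ)]) →+ ↥(D ⊓ A[(p : ℕ)]) :=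
      { toFun := fun x ↦ ⟨p ^ k • (x : A), hmapsto x x.2⟩
        map_zero' := Subtype.ext (by simp)
        map_add' := fun x y ↦ Subtype.ext (by
          change p ^ k • ((x : A) + y) = p ^ k • (x : A) + p ^ k • (y : A)
          rw [smul_add]) }
    have hm_apply : ∀ x, ((m x : ↥(D ⊓ A[(p : ℕ)])) : A) = p ^ k • (x : A) := fun _ ↦ rfl
    -- onto, by divisibility
    have hsurj : Function.Surjective m := by
      rintro ⟨y, hyD, hyp⟩
      obtain ⟨z, hzD, hz⟩ := exists_pow_smul_eq hdiv k hyD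
      have hz' : z ∈ D ⊓ A[(p ^ (k + 1) : ℕ)] := by
        refine ⟨hzD, AddSubgroup.torsionBy.nsmul_iff.mpr ?_⟩
        rw [pow_succ', mul_smul, hz]
        exact AddSubgroup.torsionBy.nsmul_iff.mp hyp
      exact ⟨⟨z, hz'⟩, Subtype.ext hz⟩
    -- kernel `= D ⊓ A[p^k]` (transported into the subtype)
    have hker : Nat.card m.ker = p ^ k := by
      rw [← ihcard]
      refine Nat.card_congr ?_
      refine { toFun := fun x ↦ ⟨(x.1 : A), x.1.2.1, AddSubgroup.torsionBy.nsmul_iff.mpr ?_⟩,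
               invFun := fun y ↦ ⟨⟨(y : A), y.2.1, ?_⟩, ?_⟩,
               left_inv := fun x ↦ by ext; rfl,
               right_inv := fun y ↦ by ext; rfl }
      · have h := x.2
        rw [AddMonoidHom.mem_ker] at h
        have h' := congrArg Subtype.val h
        rw [hm_apply] at h'
        exact h'
      · refine AddSubgroup.torsionBy.nsmul_iff.mpr ?_
        rw [pow_succ', mul_smul, AddSubgroup.torsionBy.nsmul_iff.mp y.2.2, smul_zero]
      · rw [AddMonoidHom.mem_ker]
        exact Subtype.ext (AddSubgroup.torsionBy.nsmul_iff.mp y.2.2)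
    have hrange : Nat.card m.range = p := by
      rw [AddMonoidHom.range_eq_top.mpr hsurj, AddSubgroup.card_top, hcard]
    have hcard' : Nat.card ↥(D ⊓ A[(p ^ (k + 1) : ℕ)]) = p ^ (k + 1) := by
      rw [← AddSubgroup.card_mul_index m.ker, AddSubgroup.index_ker, hker, hrange, pow_succ]
    refine ⟨hcard', ?_⟩
    -- an element of order `p^{k+1}`: divide a non-zero element of `D ⊓ A[p]` by `p^k`
    haveI : Finite ↥(D ⊓ A[(p : ℕ)]) := Nat.finite_of_card_ne_zero (by rw [hcard]; exact hp.ne_zero)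
    obtain ⟨⟨y, hy⟩, hy1⟩ : ∃ y : ↥(D ⊓ A[(p : ℕ)]), y ≠ 0 := by
      by_contra h
      push Not at h
      haveI : Subsingleton ↥(D ⊓ A[(p : ℕ)]) := ⟨fun a b ↦ by rw [h a, h b]⟩
      have := hcard
      rw [Nat.card_of_subsingleton (0 : ↥(D ⊓ A[(p : ℕ)]))] at this
      exact hp.one_lt.ne this
    have hy0 : y ≠ 0 := fun h ↦ hy1 (Subtype.ext h)
    obtain ⟨z, hzD, hz⟩ := exists_pow_smul_eq hdiv k hy.1
    have hzk1 : p ^ (k + 1) • z = 0 := by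
      rw [pow_succ', mul_smul, hz]
      exact AddSubgroup.torsionBy.nsmul_iff.mp hy.2
    refine ⟨z, ⟨hzD, AddSubgroup.torsionBy.nsmul_iff.mpr hzk1⟩, ?_⟩
    exact addOrderOf_eq_prime_pow (by rw [hz]; exact hy0) hzk1

/-- A `p`-divisible subgroup containing `A[p]` contains every `A[p^k]`. [folklore] -/
private theorem torsionBy_pow_le (hdiv : ∀ x ∈ D, ∃ y ∈ D, p • y = x) (hle : A[(p : ℕ)] ≤ D)
    (k : ℕ) :
    A[(p ^ k : ℕ)] ≤ D := by
  induction k with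
  | zero =>
    intro x hx
    have h := AddSubgroup.torsionBy.nsmul_iff.mp hx
    rw [pow_zero, one_smul] at h
    rw [h]
    exact D.zero_mem
  | succ k ih =>
    intro x hx
    -- `p^k • x ∈ A[p] ≤ D`, so `p^k • x = p^k • y` with `y ∈ D`; then `x - y ∈ A[p^k] ≤ D`
    have hpx : p ^ k • x ∈ D := hle (AddSubgroup.torsionBy.nsmul_iff.mpr (by
      rw [smul_smul, ← pow_succ']; exact AddSubgroup.torsionBy.nsmul_iff.mp hx))
    obtain ⟨y, hyD, hy⟩ := exists_pow_smul_eq hdiv k hpx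
    have hxy : x - y ∈ A[(p ^ k : ℕ)] := AddSubgroup.torsionBy.nsmul_iff.mpr (by
      rw [smul_sub, hy, sub_self])
    have := D.add_mem (ih hxy) hyD
    rwa [sub_add_cancel] at this

end Summit.BirchSwinnertonDyer.BirchSwinnertonDyer.Theorems.StableDivisibleNF

/-! ## The theorem over a number field -/

namespace WeierstrassCurve

open Literature.NumberTheory.EllipticCurves
  Summit.BirchSwinnertonDyer.BirchSwinnertonDyer.Theorems

variable {K : Type} [Field K] [NumberField K] (W : WeierstrassCurve K) [W.IsElliptic] {p : ℕ} [Fact p.Prime]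

/-- **A non-zero `Γ_K`-stable `p`-divisible subgroup of `E(K̄)[p^∞]` contains `E[p]`, for `E` over a number field `K` WITHOUT
`K`-rational CM.** Hypotheses: `D ≤ E(K̄)` `p`-primary, `p`-divisible, `Γ_K`-stable, non-zero; `¬ W.HasRationalCM`. Proof verbatim the
`ℚ`-file's (`GaloisStableDivisibleSubgroupProofs`): cyclic layers → quotient `K`-isogenies → Shafarevich over `K` → an endomorphism
`f_j ∘ ι ∘ g_k ∈ End_K(E) = ℤ` with kernel of order `p^{j+k}` containing a point of order `p^k`, `j < k` — absurd.
[cite: SilvermanAEC2009, Cor. IX.6.2, Prop. III.4.12 and Thm. III.6.1] [cite: GreenbergLNM1716, §1 p. 62] -/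
theorem geomTorsion_le_of_stable_divisible_of_not_hasRationalCM (hCM : ¬ W.HasRationalCM) {D : AddSubgroup W.geomPoints}
    (hprim : ∀ P ∈ D, ∃ k : ℕ, p ^ k • P = 0)
    (hdiv : ∀ P ∈ D, ∃ Q ∈ D, p • Q = P)
    (hstab : ∀ (σ : Field.absoluteGaloisGroup K) (P : W.geomPoints), P ∈ D → σ • P ∈ D)
    (hne : D ≠ ⊥) :
    geomTorsion W (p : ℤ) ≤ D := by
  have hp : p.Prime := Fact.out
  by_contra hnot
  -- `#(D ⊓ E[p]) = p`
  have hcard1 : Nat.card ↥(D ⊓ geomTorsion W (p : ℤ)) = p := by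
    have hle : Nat.card ↥(D ⊓ geomTorsion W (p : ℤ)) ≤ p :=
      natCard_inf_geomTorsion_prime_le W D hp (Nat.cast_ne_zero.mpr hp.ne_zero) hnot
    haveI : Finite ↥(D ⊓ geomTorsion W (p : ℤ)) := finite_inf_geomTorsion W D hp.ne_zero
    haveI : Finite (geomTorsion W (p : ℤ)) := finite_geomTorsion_natCast W hp.ne_zero
    have hdvd : Nat.card ↥(D ⊓ geomTorsion W (p : ℤ)) ∣ p ^ 2 := by
      rw [← natCard_geomTorsion_eq_sq W (Nat.cast_ne_zero.mpr hp.ne_zero)]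
      exact AddSubgroup.card_dvd_of_le inf_le_right
    obtain ⟨i, hi, hEq⟩ := (Nat.dvd_prime_pow hp).mp hdvd
    obtain ⟨x, hxD, hx0, hpx⟩ := StableDivisibleNF.exists_ne_zero_p_smul_eq_zero hprim hne
    have hne1 : Nat.card ↥(D ⊓ geomTorsion W (p : ℤ)) ≠ 1 := by
      intro h1
      haveI := (Nat.card_eq_one_iff_unique.mp h1).1
      have hx : (⟨x, hxD, AddSubgroup.torsionBy.nsmul_iff.mpr hpx⟩ : ↥(D ⊓ geomTorsion W (p : ℤ)))
          = 0 := Subsingleton.elim _ _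
      exact hx0 (congrArg Subtype.val hx)
    interval_cases i
    · rw [pow_zero] at hEq; exact absurd hEq hne1
    · rw [hEq, pow_one]
    · rw [hEq] at hle
      exact absurd hle (not_le.mpr (by nlinarith [hp.one_lt]))
  -- the layers `S k = D ⊓ E[p^k]`: order `p^k`, an element of order `p^k`, finite, `Γ_ℚ`-stable
  set S : ℕ → AddSubgroup W.geomPoints := fun k ↦ D ⊓ geomTorsion W ((p ^ k : ℕ) : ℤ) with hS
  have hSk : ∀ k, Nat.card ↥(S k) = p ^ k ∧ ∃ P ∈ S k, addOrderOf P = p ^ k := fun k ↦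
    StableDivisibleNF.natCard_inf_torsionBy_pow_eq hdiv (by exact_mod_cast hcard1) k
  have hSfin : ∀ k, (S k : Set W.geomPoints).Finite := fun k ↦
    Nat.finite_of_card_ne_zero ((hSk k).1 ▸ pow_ne_zero k hp.ne_zero)
  have hSstab : ∀ k (σ : Field.absoluteGaloisGroup K) (P : W.geomPoints), P ∈ S k → σ • P ∈ S k :=
    fun k σ P hP ↦ ⟨hstab σ P hP.1, smul_mem_torsionBy σ hP.2⟩
  -- quotient isogenies `g k : E → E_k`, duals `f k : E_k → E`
  choose Wq hWq g f hker hfg _ using fun k ↦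
    W.exists_isogeny_ker_eq_and_comp_eq_nsmul_holds (S k) (hSfin k) (hSstab k)
  -- finitely many `ℚ`-isomorphism classes among the `E_k`
  obtain ⟨F, hF⟩ := finite_isogenyClass_holds W
  have hmem : ∀ k, ∃ C : VariableChange K, C • Wq k ∈ F := fun k ↦
    @hF (Wq k) (hWq k) ⟨g k⟩
  choose C hC using hmem
  obtain ⟨j₀, k₀, hjk, hEq⟩ :=
    Finite.exists_ne_map_eq_of_infinite (fun k : ℕ ↦ (⟨C k • Wq k, hC k⟩ : F))
  have hEq' : C j₀ • Wq j₀ = C k₀ • Wq k₀ := congrArg Subtype.val hEq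
  -- without loss of generality `j < k`
  obtain ⟨j, k, hjk', hjkEq⟩ : ∃ j k : ℕ, j < k ∧ C j • Wq j = C k • Wq k := by
    rcases lt_or_gt_of_ne hjk with h | h
    · exact ⟨j₀, k₀, h, hEq'⟩
    · exact ⟨k₀, j₀, h, hEq'.symm⟩
  haveI := hWq j
  haveI := hWq k
  -- `ι : E_k ≅ E_j`, degree `1`
  obtain ⟨ι, hι⟩ := exists_isogeny_degree_eq_one_of_smul_eq_smul hjkEq
  -- `α = f_j ∘ ι ∘ g_k ∈ End_ℚ(E) = ℤ`
  set α : Isogeny W W := (f j).comp (ι.comp (g k)) with hα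
  obtain ⟨n, hn⟩ : ∃ n : ℤ, @Eq (AddMonoid.End W.geomPoints) α.toAddMonoidHom n := by
    by_contra hne'
    push Not at hne'
    exact hCM ⟨_, α.toAddMonoidHom_mem_endRing, hne'⟩
  have hαn : ∀ P, α P = n • P := fun P ↦ by
    have := DFunLike.congr_fun hn P
    rw [AddMonoid.End.intCast_apply] at this
    exact this
  -- kernel orders
  have hcardker : ∀ i, Nat.card (g i).toAddMonoidHom.ker = p ^ i := fun i ↦ by
    rw [hker i]; exact (hSk i).1
  have hf : Nat.card (f j).toAddMonoidHom.ker = p ^ j := by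
    have e := AddMonoidHom.natCard_ker_comp_of_surjective (f j).toAddMonoidHom (g j).toAddMonoidHom
      (g j).surjective
    have hfg' : ((f j).comp (g j)).toAddMonoidHom.ker = geomTorsion W ((p ^ j : ℕ) : ℤ) := by
      ext P
      rw [AddMonoidHom.mem_ker, Isogeny.coe_toAddMonoidHom, Isogeny.comp_apply, hfg j,
        (hSk j).1, AddSubgroup.torsionBy.nsmul_iff]
    change Nat.card ((f j).comp (g j)).toAddMonoidHom.ker = _ at e
    rw [hfg', natCard_geomTorsion_eq_sq W (by exact_mod_cast (pow_ne_zero j hp.ne_zero)),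
      hcardker j, sq] at e
    exact (Nat.eq_of_mul_eq_mul_right (pow_pos hp.pos j) e).symm
  have hιg : Nat.card (ι.comp (g k)).toAddMonoidHom.ker = p ^ k := by
    have e := AddMonoidHom.natCard_ker_comp_of_surjective ι.toAddMonoidHom (g k).toAddMonoidHom
      (g k).surjective
    change Nat.card (ι.comp (g k)).toAddMonoidHom.ker = _ at e
    rw [e, hcardker k]
    change ι.degree * p ^ k = p ^ k
    rw [hι, one_mul]
  have hαcard : Nat.card α.toAddMonoidHom.ker = p ^ j * p ^ k := by
    have e := AddMonoidHom.natCard_ker_comp_of_surjective (f j).toAddMonoidHom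
      (ι.comp (g k)).toAddMonoidHom (ι.comp (g k)).surjective
    change Nat.card α.toAddMonoidHom.ker = _ at e
    rw [e, hf, hιg]
  -- `n ≠ 0` and `#ker α = n²`
  have hn0 : n ≠ 0 := by
    rintro rfl
    have hker0 : α.toAddMonoidHom.ker = ⊤ := by
      ext P
      simp only [AddMonoidHom.mem_ker, Isogeny.coe_toAddMonoidHom, hαn, zero_smul,
        AddSubgroup.mem_top]
    have := hαcard
    rw [hker0, AddSubgroup.card_top, Nat.card_eq_zero_of_infinite] at this
    exact (mul_pos (pow_pos hp.pos j) (pow_pos hp.pos k)).ne' this.symm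
  have hαker : α.toAddMonoidHom.ker = geomTorsion W n := by
    ext P
    rw [AddMonoidHom.mem_ker, Isogeny.coe_toAddMonoidHom, hαn]
    rfl
  have key : n.natAbs ^ 2 = p ^ (j + k) := by
    rw [← natCard_geomTorsion_int_eq_sq W hn0, ← hαker, hαcard, pow_add]
  -- a point of order `p^k` in `ker g_k ≤ ker α = E[n]`
  obtain ⟨P, hPS, hPord⟩ := (hSk k).2
  have hPα : α P = 0 := by
    have hPg : (g k) P = 0 := by
      have : P ∈ (g k).toAddMonoidHom.ker := by rw [hker k]; exact hPS
      exact this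
    rw [hα, Isogeny.comp_apply, Isogeny.comp_apply, hPg, map_zero, map_zero]
  have hdvd : p ^ k ∣ n.natAbs := by
    rw [← hPord, ← Int.natCast_dvd, ← addOrderOf_dvd_iff_zsmul_eq_zero.symm.eq, ← hαn P]
    exact hPα
  have hdvd2 : p ^ (2 * k) ∣ p ^ (j + k) := by
    rw [← key, pow_mul', ]
    exact pow_dvd_pow_of_dvd hdvd 2
  have := (Nat.pow_dvd_pow_iff_le_right hp.one_lt).mp hdvd2
  omega

/-- **… hence contains every `E[p^k]`** (divisibility). [cite: GreenbergLNM1716, §1 p. 62] -/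
theorem geomTorsion_pow_le_of_stable_divisible_of_not_hasRationalCM (hCM : ¬ W.HasRationalCM) {D : AddSubgroup W.geomPoints}
    (hprim : ∀ P ∈ D, ∃ k : ℕ, p ^ k • P = 0)
    (hdiv : ∀ P ∈ D, ∃ Q ∈ D, p • Q = P)
    (hstab : ∀ (σ : Field.absoluteGaloisGroup K) (P : W.geomPoints), P ∈ D → σ • P ∈ D)
    (hne : D ≠ ⊥) (k : ℕ) :
    geomTorsion W ((p ^ k : ℕ) : ℤ) ≤ D :=
  StableDivisibleNF.torsionBy_pow_le hdiv
    (W.geomTorsion_le_of_stable_divisible_of_not_hasRationalCM hCM hprim hdiv hstab hne) k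

/-- **… hence is all of `E[p^∞]`**: over a number field `K`, an elliptic curve WITHOUT `K`-rational complex multiplication has
no `Γ_K`-stable `p`-divisible subgroup of `E(K̄)[p^∞]` other than `0` and `E[p^∞]` (`T_p E` has no `Γ_K`-stable `ℤ_p`-line).
[cite: GreenbergLNM1716, §1 p. 62] [cite: Serre1968, IV.2.1–2.2] -/
theorem geomPrimaryTorsion_le_of_stable_divisible_of_not_hasRationalCM (hCM : ¬ W.HasRationalCM) {D : AddSubgroup W.geomPoints}
    (hprim : ∀ P ∈ D, ∃ k : ℕ, p ^ k • P = 0)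
    (hdiv : ∀ P ∈ D, ∃ Q ∈ D, p • Q = P)
    (hstab : ∀ (σ : Field.absoluteGaloisGroup K) (P : W.geomPoints), P ∈ D → σ • P ∈ D)
    (hne : D ≠ ⊥) :
    geomPrimaryTorsion W p ≤ D := by
  rintro P ⟨k, hk⟩
  exact W.geomTorsion_pow_le_of_stable_divisible_of_not_hasRationalCM hCM hprim hdiv hstab hne k
    (AddSubgroup.torsionBy.nsmul_iff.mpr hk)

end WeierstrassCurve

end
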